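import Summits.ResolutionOfSingularities.ResolutionOfSingularities.Theorems.EquisingularLiftEquisingularLiftNatDOddTower
import Summits.ResolutionOfSingularities.ResolutionOfSingularities.Theorems.EquisingularLiftEquisingularLiftNatSecondOrderA3Recognition
import HarnessLib

/-!
# [OURS] GENERAL-TAIL `D₄` RECOGNITION: `y₂² + y₀y₁(y₀ + y₁) + y₂·Q + B` with ARBITRARY `Q ∈ (y)²`, `B ∈ (y)⁴` has blow-up depth EXACTLY `1` in every
# blow-up tower — every field, every characteristic (the binary cubic in rational normal form, everything else free)
# (cruxes `Theses.EquisingularLift.EquisingularLiftNat` / `…NatThree` / `EquisingularLift`, stmt-ResolutionOfSingularities-20038 / -20148 / -15660)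

[OURS · leafhand-res-equisingularlift-12 g1, 2026-09-01; cell `pub/decomp-res`] AI-produced, weaker than expert review; NOT a statement of any manuscript;
nothing here proves resolution of singularities in positive characteristic.  DEF-FREE helper; no `sorry`; standard axioms; ZERO named hypotheses.

leafhand-12 g0's remaining item «[M] general D₄ recognition».  A double point `f = x² + c₃(y,z) + x·q₂ + (order ≥ 4)` whose binary cubic `c₃` has three
distinct RATIONAL roots is, after a linear change of `y, z`, of the form treated here: `c₃ = y₀y₁(y₀+y₁)`, the cubic terms divisible by `x = y₂` collected
in `y₂·Q` (`Q ∈ (y)²`, not necessarily homogeneous) and the rest in `B ∈ (y)⁴`.  Chart `0` carries `T₂² + T₀·(T₁(1+T₁) + T₂Q̂ + T₀B̂)`, singular on the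
exceptional divisor exactly at the marks `T₁ ∈ {0, -1}`; at each mark the translate splits (jets of the opaque `Q̂, B̂`: ✓ `sub_homogeneousComponent_mem_pow_succ`)
as a NODE `T₂² + T₀·(±T₁ + qT₂ + bT₀)` plus a cubic form plus a `(T)⁴` tail — one-step in EVERY characteristic; chart `1` is the mirror image, chart `2` empty.

* `SecondOrderPoint.jet_split` — `p = C(p₀) + p₁ + p₂`, `p₁` a linear form, `p₂ ∈ (T)²`;
* `SecondOrderPoint.nodeL₀_*`, `nodeL₁_*` — the perturbed nodes `T₂² + T₀(cT₁ + qT₂ + bT₀)`, `T₂² + T₁(cT₀ + qT₂ + bT₁)` (`c ≠ 0`): non-zero quadratic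
  forms, first-order in every characteristic, one-step data with any cubic form and any `(T)⁴` tail;
* ★★★ `OneStep.towerLevel_origin_D₄_general` — for all `Q ∈ (y)²`, `B ∈ (y)⁴` and `f = y₂² + (y₀²y₁ + y₀y₁² + (y₂Q + B))`, the origin of `Spec K[y]/(f)` has
  `D`-level `1` in every blow-up tower `D`.

Honest label: the vertex / `IsoHypPoint` corollary needs in addition «chart singular only at the origin» and regular other charts, which depend on the
tail (hypotheses for the user, as in ✓ `isoHypPoint_of_towerVertices`).  Closes no registered stub.

References: [Hartshorne1977, I Thm. 5.1, I Ex. 5.6, II Ex. 7.12]; [Lipman1969, §24]; [StacksProject, Tags 0804, 080E]; through the cited tree files.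
-/

set_option linter.dupNamespace false -- mandated namespace `Summit.<Summit>.<Problem>` of this single-conjunct summit

noncomputable section

open CategoryTheory CategoryTheory.Limits AlgebraicGeometry TopologicalSpace Topology
open MvPolynomial
open Literature.AlgebraicGeometry.Resolution
open AlgebraicGeometry.Scheme.IdealSheafData

namespace Summit.ResolutionOfSingularities.ResolutionOfSingularities.Cruxes.EquisingularLiftNat.Sections

namespace SecondOrderPoint

variable (K : Type) [Field K]

/-- **JET SPLITTING**: `p = C(p₀) + p₁ + p₂` with `p₁` a linear form and `p₂ ∈ (T)²`. [folklore] -/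
theorem jet_split (p : MvPolynomial (Fin 3) K) :
    ∃ (p₀ : K) (p₁ p₂ : MvPolynomial (Fin 3) K), p₁.IsHomogeneous 1 ∧ p₂ ∈ Ideal.span (Set.range (X : Fin 3 → MvPolynomial (Fin 3) K)) ^ 2 ∧
      p = C p₀ + p₁ + p₂ := by
  have h0 : p ∈ Ideal.span (Set.range (X : Fin 3 → MvPolynomial (Fin 3) K)) ^ 0 := by
    rw [pow_zero, Ideal.one_eq_top]; trivial
  have h1 := sub_homogeneousComponent_mem_pow_succ K h0
  have h2 := sub_homogeneousComponent_mem_pow_succ K h1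
  refine ⟨coeff 0 p, homogeneousComponent 1 (p - homogeneousComponent 0 p), _, homogeneousComponent_isHomogeneous _ _, h2, ?_⟩
  rw [← homogeneousComponent_zero]
  ring

/-! ## Perturbed nodes `T₂² + T_l·(c·T_j + q·T₂ + b·T_l)`, `{l, j} = {0, 1}` -/

/-- The perturbed node (chart `0`) is a non-zero quadratic form. [folklore] -/
theorem nodeL₀_cone (c q b : K) :
    (X 2 ^ 2 + X 0 * (C c * X 1 + C q * X 2 + C b * X 0) : MvPolynomial (Fin 3) K).IsHomogeneous 2 ∧
    (X 2 ^ 2 + X 0 * (C c * X 1 + C q * X 2 + C b * X 0) : MvPolynomial (Fin 3) K) ≠ 0 := by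
  refine ⟨?_, fun h => ?_⟩
  · refine (isHomogeneous_X_pow (2 : Fin 3) 2).add ?_
    have hL : (C c * X 1 + C q * X 2 + C b * X 0 : MvPolynomial (Fin 3) K).IsHomogeneous 1 := by
      refine IsHomogeneous.add (IsHomogeneous.add ?_ ?_) ?_
      · simpa using (isHomogeneous_C (Fin 3) c).mul (isHomogeneous_X K (1 : Fin 3))
      · simpa using (isHomogeneous_C (Fin 3) q).mul (isHomogeneous_X K (2 : Fin 3))
      · simpa using (isHomogeneous_C (Fin 3) b).mul (isHomogeneous_X K (0 : Fin 3))
    exact (isHomogeneous_X K (0 : Fin 3)).mul hL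
  · have h1 := congrArg (eval (Pi.single (2 : Fin 3) (1 : K))) h
    simp at h1

/-- The perturbed node (chart `1`) is a non-zero quadratic form. [folklore] -/
theorem nodeL₁_cone (c q b : K) :
    (X 2 ^ 2 + X 1 * (C c * X 0 + C q * X 2 + C b * X 1) : MvPolynomial (Fin 3) K).IsHomogeneous 2 ∧
    (X 2 ^ 2 + X 1 * (C c * X 0 + C q * X 2 + C b * X 1) : MvPolynomial (Fin 3) K) ≠ 0 := by
  refine ⟨?_, fun h => ?_⟩
  · refine (isHomogeneous_X_pow (2 : Fin 3) 2).add ?_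
    have hL : (C c * X 0 + C q * X 2 + C b * X 1 : MvPolynomial (Fin 3) K).IsHomogeneous 1 := by
      refine IsHomogeneous.add (IsHomogeneous.add ?_ ?_) ?_
      · simpa using (isHomogeneous_C (Fin 3) c).mul (isHomogeneous_X K (0 : Fin 3))
      · simpa using (isHomogeneous_C (Fin 3) q).mul (isHomogeneous_X K (2 : Fin 3))
      · simpa using (isHomogeneous_C (Fin 3) b).mul (isHomogeneous_X K (1 : Fin 3))
    exact (isHomogeneous_X K (1 : Fin 3)).mul hL
  · have h1 := congrArg (eval (Pi.single (2 : Fin 3) (1 : K))) h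
    simp at h1

/-- **The perturbed node `T₂² + T₀(cT₁ + qT₂ + bT₀)` (`c ≠ 0`) is first-order in EVERY characteristic.** [cite: Hartshorne1977, I Thm. 5.1] -/
theorem nodeL₀_firstOrder {c : K} (hc : c ≠ 0) (q b : K) (Ψ₁ : MvPolynomial (Fin 3) K) (P : Ideal (MvPolynomial (Fin 3) K)) (hP : P.IsPrime)
    (hΦ : (X 2 ^ 2 + X 0 * (C c * X 1 + C q * X 2 + C b * X 0) : MvPolynomial (Fin 3) K) ∈ P)
    (hd : ∀ i, pderiv i (X 2 ^ 2 + X 0 * (C c * X 1 + C q * X 2 + C b * X 0) : MvPolynomial (Fin 3) K) ∈ P)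
    (_hΨ : Ψ₁ ∈ P) (i : Fin 3) : (X i : MvPolynomial (Fin 3) K) ∈ P := by
  have hd1 : pderiv 1 (X 2 ^ 2 + X 0 * (C c * X 1 + C q * X 2 + C b * X 0) : MvPolynomial (Fin 3) K) = C c * X 0 := by
    simp only [map_add, pderiv_mul, pderiv_pow, pderiv_C, pderiv_X_self, pderiv_X_of_ne (by decide : (0 : Fin 3) ≠ 1),
      pderiv_X_of_ne (by decide : (2 : Fin 3) ≠ 1)]
    ring
  have hd0 : pderiv 0 (X 2 ^ 2 + X 0 * (C c * X 1 + C q * X 2 + C b * X 0) : MvPolynomial (Fin 3) K) =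
      (C c * X 1 + C q * X 2) + (C b + C b) * X 0 := by
    simp only [map_add, pderiv_mul, pderiv_pow, pderiv_C, pderiv_X_self, pderiv_X_of_ne (by decide : (1 : Fin 3) ≠ 0),
      pderiv_X_of_ne (by decide : (2 : Fin 3) ≠ 0)]
    ring
  have hX0 : (X 0 : MvPolynomial (Fin 3) K) ∈ P := by
    refine mem_of_C_mul_mem K hc P hP ?_
    rw [← hd1]; exact hd 1
  have hL : (C c * X 1 + C q * X 2 : MvPolynomial (Fin 3) K) ∈ P := by
    have h := hd 0
    rw [hd0] at h
    have e : (C c * X 1 + C q * X 2 : MvPolynomial (Fin 3) K) = ((C c * X 1 + C q * X 2) + (C b + C b) * X 0) - (C b + C b) * X 0 := by ring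
    rw [e]; exact P.sub_mem h (P.mul_mem_left _ hX0)
  have hX2 : (X 2 : MvPolynomial (Fin 3) K) ∈ P := by
    refine hP.mem_of_pow_mem 2 ?_
    have e : (X 2 ^ 2 : MvPolynomial (Fin 3) K) = (X 2 ^ 2 + X 0 * (C c * X 1 + C q * X 2 + C b * X 0)) - X 0 * (C c * X 1 + C q * X 2 + C b * X 0) := by
      ring
    rw [e]; exact P.sub_mem hΦ (P.mul_mem_right _ hX0)
  have hX1 : (X 1 : MvPolynomial (Fin 3) K) ∈ P := by
    refine mem_of_C_mul_mem K hc P hP ?_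
    have e : (C c * X 1 : MvPolynomial (Fin 3) K) = (C c * X 1 + C q * X 2) - C q * X 2 := by ring
    rw [e]; exact P.sub_mem hL (P.mul_mem_left _ hX2)
  fin_cases i
  · simpa using hX0
  · simpa using hX1
  · simpa using hX2

/-- **The perturbed node `T₂² + T₁(cT₀ + qT₂ + bT₁)` (`c ≠ 0`) is first-order in EVERY characteristic.** [cite: Hartshorne1977, I Thm. 5.1] -/
theorem nodeL₁_firstOrder {c : K} (hc : c ≠ 0) (q b : K) (Ψ₁ : MvPolynomial (Fin 3) K) (P : Ideal (MvPolynomial (Fin 3) K)) (hP : P.IsPrime)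
    (hΦ : (X 2 ^ 2 + X 1 * (C c * X 0 + C q * X 2 + C b * X 1) : MvPolynomial (Fin 3) K) ∈ P)
    (hd : ∀ i, pderiv i (X 2 ^ 2 + X 1 * (C c * X 0 + C q * X 2 + C b * X 1) : MvPolynomial (Fin 3) K) ∈ P)
    (_hΨ : Ψ₁ ∈ P) (i : Fin 3) : (X i : MvPolynomial (Fin 3) K) ∈ P := by
  have hd0 : pderiv 0 (X 2 ^ 2 + X 1 * (C c * X 0 + C q * X 2 + C b * X 1) : MvPolynomial (Fin 3) K) = C c * X 1 := by
    simp only [map_add, pderiv_mul, pderiv_pow, pderiv_C, pderiv_X_self, pderiv_X_of_ne (by decide : (1 : Fin 3) ≠ 0),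
      pderiv_X_of_ne (by decide : (2 : Fin 3) ≠ 0)]
    ring
  have hd1 : pderiv 1 (X 2 ^ 2 + X 1 * (C c * X 0 + C q * X 2 + C b * X 1) : MvPolynomial (Fin 3) K) =
      (C c * X 0 + C q * X 2) + (C b + C b) * X 1 := by
    simp only [map_add, pderiv_mul, pderiv_pow, pderiv_C, pderiv_X_self, pderiv_X_of_ne (by decide : (0 : Fin 3) ≠ 1),
      pderiv_X_of_ne (by decide : (2 : Fin 3) ≠ 1)]
    ring
  have hX1 : (X 1 : MvPolynomial (Fin 3) K) ∈ P := by
    refine mem_of_C_mul_mem K hc P hP ?_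
    rw [← hd0]; exact hd 0
  have hL : (C c * X 0 + C q * X 2 : MvPolynomial (Fin 3) K) ∈ P := by
    have h := hd 1
    rw [hd1] at h
    have e : (C c * X 0 + C q * X 2 : MvPolynomial (Fin 3) K) = ((C c * X 0 + C q * X 2) + (C b + C b) * X 1) - (C b + C b) * X 1 := by ring
    rw [e]; exact P.sub_mem h (P.mul_mem_left _ hX1)
  have hX2 : (X 2 : MvPolynomial (Fin 3) K) ∈ P := by
    refine hP.mem_of_pow_mem 2 ?_
    have e : (X 2 ^ 2 : MvPolynomial (Fin 3) K) = (X 2 ^ 2 + X 1 * (C c * X 0 + C q * X 2 + C b * X 1)) - X 1 * (C c * X 0 + C q * X 2 + C b * X 1) := by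
      ring
    rw [e]; exact P.sub_mem hΦ (P.mul_mem_right _ hX1)
  have hX0 : (X 0 : MvPolynomial (Fin 3) K) ∈ P := by
    refine mem_of_C_mul_mem K hc P hP ?_
    have e : (C c * X 0 : MvPolynomial (Fin 3) K) = (C c * X 0 + C q * X 2) - C q * X 2 := by ring
    rw [e]; exact P.sub_mem hL (P.mul_mem_left _ hX2)
  fin_cases i
  · simpa using hX0
  · simpa using hX1
  · simpa using hX2

end SecondOrderPoint

namespace OneStep

variable (K : Type) [Field K]

set_option maxHeartbeats 400000 in -- two charts × two marks, each with a jet splitting of the opaque tails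
/-- ★★★ **GENERAL-TAIL `D₄` RECOGNITION**: for all `Q ∈ (y)²`, `B ∈ (y)⁴` and every `f = y₂² + (y₀²y₁ + y₀y₁² + (y₂Q + B))`, the origin of `Spec K[y]/(f)` has
`D`-level `1` in every blow-up tower `D` — every field, every characteristic. [OURS] [cite: Hartshorne1977, I Thm. 5.1, I Ex. 5.6] [cite: Lipman1969, §24]
[cite: StacksProject, Tags 0804, 080E] -/
theorem towerLevel_origin_D₄_general (D : ℕ → ∀ Γ : Scheme.{0}, Γ → Prop)
    (hD0 : ∀ (Γ : Scheme.{0}) (y : Γ), IsClosed (({y} : Set Γ)) →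
      (D 0 Γ y ↔ ∀ (hy : IsClosed (({y} : Set Γ))) (Z : Scheme.{0}) (τ : Z ⟶ Γ), IsBlowup τ (vanishingIdeal ⟨{y}, hy⟩) →
        ∀ z : Z, τ z = y → IsRegularLocalRing (Z.presheaf.stalk z)))
    (hDsucc : ∀ (d : ℕ) (Γ : Scheme.{0}) (y : Γ), IsClosed (({y} : Set Γ)) →
      (D (d + 1) Γ y ↔ ∀ (hy : IsClosed (({y} : Set Γ))) (Z : Scheme.{0}) (τ : Z ⟶ Γ), IsBlowup τ (vanishingIdeal ⟨{y}, hy⟩) →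
        ∃ S' : Finset Z, (∀ z : Z, τ z = y → z ∉ S' → IsRegularLocalRing (Z.presheaf.stalk z)) ∧
          ∀ z ∈ S', τ z = y ∧ IsClosed (({z} : Set Z)) ∧ ∃ d' ≤ d, D d' Z z))
    (Q B : MvPolynomial (Fin 3) K) (hQ : Q ∈ Ideal.span (Set.range (X : Fin 3 → MvPolynomial (Fin 3) K)) ^ 2)
    (hB : B ∈ Ideal.span (Set.range (X : Fin 3 → MvPolynomial (Fin 3) K)) ^ 4) :
    ∀ (f : MvPolynomial (Fin 3) K), f = X 2 ^ 2 + (X 0 ^ 2 * X 1 + X 0 * X 1 ^ 2 + (X 2 * Q + B)) →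
      ∀ (y₀ : Spec (CommRingCat.of (MvPolynomial (Fin 3) K ⧸ Ideal.span {f}))),
        y₀.asIdeal = Ideal.map (Ideal.Quotient.mk (Ideal.span {f})) (Ideal.span (Set.range (X : Fin 3 → MvPolynomial (Fin 3) K))) →
        D 1 (Spec (CommRingCat.of (MvPolynomial (Fin 3) K ⧸ Ideal.span {f}))) y₀ := by
  classical
  intro f hf y₀ hy₀
  subst hf
  set I : Ideal (MvPolynomial (Fin 3) K) := Ideal.span (Set.range (X : Fin 3 → MvPolynomial (Fin 3) K)) with hI
  have hXI : ∀ i : Fin 3, (X i : MvPolynomial (Fin 3) K) ∈ I := fun i => Ideal.subset_span (Set.mem_range_self i)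
  have hΦ : (X 2 ^ 2 : MvPolynomial (Fin 3) K).IsHomogeneous 2 := isHomogeneous_X_pow (2 : Fin 3) 2
  have hΦ0 : (X 2 ^ 2 : MvPolynomial (Fin 3) K) ≠ 0 := pow_ne_zero _ (X_ne_zero 2)
  have hT : X 2 * Q + B ∈ I ^ (2 + 1) := by
    refine Ideal.add_mem _ ?_ (Ideal.pow_le_pow_right (by norm_num) hB)
    rw [pow_succ']; exact Ideal.mul_mem_mul (hXI 2) hQ
  have hΨ : (X 0 ^ 2 * X 1 + X 0 * X 1 ^ 2 + (X 2 * Q + B) : MvPolynomial (Fin 3) K) ∈ I ^ (2 + 1) := by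
    refine Ideal.add_mem _ (Ideal.add_mem _ ?_ ?_) hT
    · simpa using SecondOrderPoint.monomial_mem_pow₃ K 2 1 0 (k := 2 + 1) (by norm_num)
    · simpa using SecondOrderPoint.monomial_mem_pow₃ K 1 2 0 (k := 2 + 1) (by norm_num)
  -- the opaque tails in the two charts
  obtain ⟨Q₀, hQ₀⟩ := FirstOrderPoint.exists_aeval_subst_eq_pow_mul K 0 hQ
  obtain ⟨B₀, hB₀⟩ := FirstOrderPoint.exists_aeval_subst_eq_pow_mul K 0 hB
  obtain ⟨Q₁, hQ₁⟩ := FirstOrderPoint.exists_aeval_subst_eq_pow_mul K 1 hQ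
  obtain ⟨B₁, hB₁⟩ := FirstOrderPoint.exists_aeval_subst_eq_pow_mul K 1 hB
  have hG₀ : aeval (fun j => X 0 * Function.update (X : Fin 3 → MvPolynomial (Fin 3) K) 0 1 j)
      (X 2 ^ 2 + (X 0 ^ 2 * X 1 + X 0 * X 1 ^ 2 + (X 2 * Q + B)) : MvPolynomial (Fin 3) K) =
      X 0 ^ 2 * (X 0 * (X 1 * (1 + X 1) + X 2 * Q₀ + X 0 * B₀) + X 2 ^ 2) := by
    simp only [map_add, map_mul, map_pow, aeval_X, Function.update_self, Function.update_of_ne (by decide : (1 : Fin 3) ≠ 0),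
      Function.update_of_ne (by decide : (2 : Fin 3) ≠ 0)]
    rw [hQ₀, hB₀]
    ring
  have hG₁ : aeval (fun j => X 1 * Function.update (X : Fin 3 → MvPolynomial (Fin 3) K) 1 1 j)
      (X 2 ^ 2 + (X 0 ^ 2 * X 1 + X 0 * X 1 ^ 2 + (X 2 * Q + B)) : MvPolynomial (Fin 3) K) =
      X 1 ^ 2 * (X 1 * (X 0 * (1 + X 0) + X 2 * Q₁ + X 1 * B₁) + X 2 ^ 2) := by
    simp only [map_add, map_mul, map_pow, aeval_X, Function.update_self, Function.update_of_ne (by decide : (0 : Fin 3) ≠ 1),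
      Function.update_of_ne (by decide : (2 : Fin 3) ≠ 1)]
    rw [hQ₁, hB₁]
    ring
  obtain ⟨G₂, hG₂, hJ₂⟩ := SecondOrderPoint.sq_chart_vacuous₂ K hΨ
  -- the level-0 payload of a perturbed node `Φ' + (Ψ₁ + Ψ'')`
  have hpay₀ : ∀ (c q b : K), c ≠ 0 → ∀ Ψ₁ Ψ'' : MvPolynomial (Fin 3) K, Ψ₁.IsHomogeneous 3 → Ψ'' ∈ I ^ 4 →
      ∀ y' : Spec (CommRingCat.of (MvPolynomial (Fin 3) K ⧸ Ideal.span {(X 2 ^ 2 + X 0 * (C c * X 1 + C q * X 2 + C b * X 0)) + (Ψ₁ + Ψ'')})),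
        y'.asIdeal = Ideal.map (Ideal.Quotient.mk (Ideal.span {(X 2 ^ 2 + X 0 * (C c * X 1 + C q * X 2 + C b * X 0)) + (Ψ₁ + Ψ'')}))
          (Ideal.span (Set.range (X : Fin 3 → MvPolynomial (Fin 3) K))) →
        ∃ d' ≤ 0, D d' (Spec (CommRingCat.of (MvPolynomial (Fin 3) K ⧸ Ideal.span {(X 2 ^ 2 + X 0 * (C c * X 1 + C q * X 2 + C b * X 0)) + (Ψ₁ + Ψ'')}))) y' := by
    intro c q b hc Ψ₁ Ψ'' hΨ₁ hΨ'' y' hy'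
    have hcone := SecondOrderPoint.nodeL₀_cone K c q b
    exact ⟨0, le_rfl, towerLevel_zero_origin K D hD0 hDsucc _ (Ψ₁ + Ψ'') (by norm_num) hcone.1 hcone.2
      (FirstOrderPoint.add_mem_pow_succ K hΨ₁ hΨ'')
      (fun l => FirstOrderPoint.exists_strictTransform K _ Ψ₁ Ψ'' hcone.1 hΨ₁ hΨ''
        (fun P hP hΦP hdP hΨP => SecondOrderPoint.nodeL₀_firstOrder K hc q b Ψ₁ P hP hΦP hdP hΨP) l) y' hy'⟩
  have hpay₁ : ∀ (c q b : K), c ≠ 0 → ∀ Ψ₁ Ψ'' : MvPolynomial (Fin 3) K, Ψ₁.IsHomogeneous 3 → Ψ'' ∈ I ^ 4 →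
      ∀ y' : Spec (CommRingCat.of (MvPolynomial (Fin 3) K ⧸ Ideal.span {(X 2 ^ 2 + X 1 * (C c * X 0 + C q * X 2 + C b * X 1)) + (Ψ₁ + Ψ'')})),
        y'.asIdeal = Ideal.map (Ideal.Quotient.mk (Ideal.span {(X 2 ^ 2 + X 1 * (C c * X 0 + C q * X 2 + C b * X 1)) + (Ψ₁ + Ψ'')}))
          (Ideal.span (Set.range (X : Fin 3 → MvPolynomial (Fin 3) K))) →
        ∃ d' ≤ 0, D d' (Spec (CommRingCat.of (MvPolynomial (Fin 3) K ⧸ Ideal.span {(X 2 ^ 2 + X 1 * (C c * X 0 + C q * X 2 + C b * X 1)) + (Ψ₁ + Ψ'')}))) y' := by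
    intro c q b hc Ψ₁ Ψ'' hΨ₁ hΨ'' y' hy'
    have hcone := SecondOrderPoint.nodeL₁_cone K c q b
    exact ⟨0, le_rfl, towerLevel_zero_origin K D hD0 hDsucc _ (Ψ₁ + Ψ'') (by norm_num) hcone.1 hcone.2
      (FirstOrderPoint.add_mem_pow_succ K hΨ₁ hΨ'')
      (fun l => FirstOrderPoint.exists_strictTransform K _ Ψ₁ Ψ'' hcone.1 hΨ₁ hΨ''
        (fun P hP hΦP hdP hΨP => SecondOrderPoint.nodeL₁_firstOrder K hc q b Ψ₁ P hP hΦP hdP hΨP) l) y' hy'⟩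
  -- the split at a mark: `T₂² + T_l·(u(c + u) + T₂R + T_l S)` with jets of `R`, `S`
  have hsplit₀ : ∀ (c : K) (R S : MvPolynomial (Fin 3) K), ∃ (q b : K) (Ψ₁ Ψ'' : MvPolynomial (Fin 3) K), Ψ₁.IsHomogeneous 3 ∧ Ψ'' ∈ I ^ 4 ∧
      (X 0 * (X 1 * (C c + X 1) + X 2 * R + X 0 * S) + X 2 ^ 2 : MvPolynomial (Fin 3) K) =
        (X 2 ^ 2 + X 0 * (C c * X 1 + C q * X 2 + C b * X 0)) + (Ψ₁ + Ψ'') := by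
    intro c R S
    obtain ⟨r₀, R₁, R₂, hR₁, hR₂, hR⟩ := SecondOrderPoint.jet_split K R
    obtain ⟨s₀, S₁, S₂, hS₁, hS₂, hS⟩ := SecondOrderPoint.jet_split K S
    refine ⟨r₀, s₀, X 0 * X 1 ^ 2 + X 0 * X 2 * R₁ + X 0 ^ 2 * S₁, X 0 * X 2 * R₂ + X 0 ^ 2 * S₂, ?_, ?_, ?_⟩
    · refine ((IsHomogeneous.add ?_ ?_)).add ?_
      · simpa using (isHomogeneous_X K (0 : Fin 3)).mul (isHomogeneous_X_pow (1 : Fin 3) 2)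
      · exact ((isHomogeneous_X K (0 : Fin 3)).mul (isHomogeneous_X K (2 : Fin 3))).mul hR₁
      · exact (isHomogeneous_X_pow (0 : Fin 3) 2).mul hS₁
    · have e4 : I ^ 4 = I ^ 2 * I ^ 2 := by rw [← pow_add]
      rw [e4]
      refine Ideal.add_mem _ (Ideal.mul_mem_mul ?_ hR₂) (Ideal.mul_mem_mul (Ideal.pow_mem_pow (hXI 0) 2) hS₂)
      rw [pow_two]; exact Ideal.mul_mem_mul (hXI 0) (hXI 2)
    · rw [hR, hS]; ring
  have hsplit₁ : ∀ (c : K) (R S : MvPolynomial (Fin 3) K), ∃ (q b : K) (Ψ₁ Ψ'' : MvPolynomial (Fin 3) K), Ψ₁.IsHomogeneous 3 ∧ Ψ'' ∈ I ^ 4 ∧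
      (X 1 * (X 0 * (C c + X 0) + X 2 * R + X 1 * S) + X 2 ^ 2 : MvPolynomial (Fin 3) K) =
        (X 2 ^ 2 + X 1 * (C c * X 0 + C q * X 2 + C b * X 1)) + (Ψ₁ + Ψ'') := by
    intro c R S
    obtain ⟨r₀, R₁, R₂, hR₁, hR₂, hR⟩ := SecondOrderPoint.jet_split K R
    obtain ⟨s₀, S₁, S₂, hS₁, hS₂, hS⟩ := SecondOrderPoint.jet_split K S
    refine ⟨r₀, s₀, X 1 * X 0 ^ 2 + X 1 * X 2 * R₁ + X 1 ^ 2 * S₁, X 1 * X 2 * R₂ + X 1 ^ 2 * S₂, ?_, ?_, ?_⟩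
    · refine ((IsHomogeneous.add ?_ ?_)).add ?_
      · simpa using (isHomogeneous_X K (1 : Fin 3)).mul (isHomogeneous_X_pow (0 : Fin 3) 2)
      · exact ((isHomogeneous_X K (1 : Fin 3)).mul (isHomogeneous_X K (2 : Fin 3))).mul hR₁
      · exact (isHomogeneous_X_pow (1 : Fin 3) 2).mul hS₁
    · have e4 : I ^ 4 = I ^ 2 * I ^ 2 := by rw [← pow_add]
      rw [e4]
      refine Ideal.add_mem _ (Ideal.mul_mem_mul ?_ hR₂) (Ideal.mul_mem_mul (Ideal.pow_mem_pow (hXI 1) 2) hS₂)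
      rw [pow_two]; exact Ideal.mul_mem_mul (hXI 1) (hXI 2)
    · rw [hR, hS]; ring
  -- translates of the chart equations to the marks
  have htr₀₀ : aeval (fun i : Fin 3 => X i + C ((0 : Fin 3 → K) i)) (X 0 * (X 1 * (1 + X 1) + X 2 * Q₀ + X 0 * B₀) + X 2 ^ 2 : MvPolynomial (Fin 3) K) =
      X 0 * (X 1 * (C (1 : K) + X 1) + X 2 * Q₀ + X 0 * B₀) + X 2 ^ 2 := by
    rw [SecondOrderPoint.aeval_translate_zero, map_one]
  have htr₀₁ : aeval (fun i : Fin 3 => X i + C ((- (Pi.single (1 : Fin 3) (1 : K)) : Fin 3 → K) i))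
      (X 0 * (X 1 * (1 + X 1) + X 2 * Q₀ + X 0 * B₀) + X 2 ^ 2 : MvPolynomial (Fin 3) K) =
      X 0 * (X 1 * (C (-1 : K) + X 1) + X 2 * aeval (fun i : Fin 3 => X i + C ((- (Pi.single (1 : Fin 3) (1 : K)) : Fin 3 → K) i)) Q₀ +
        X 0 * aeval (fun i : Fin 3 => X i + C ((- (Pi.single (1 : Fin 3) (1 : K)) : Fin 3 → K) i)) B₀) + X 2 ^ 2 := by
    simp only [map_add, map_mul, map_pow, map_one, aeval_X, Pi.neg_apply, Pi.single_eq_same, Pi.single_eq_of_ne (by decide : (0 : Fin 3) ≠ 1),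
      Pi.single_eq_of_ne (by decide : (2 : Fin 3) ≠ 1), neg_zero, map_zero, add_zero, map_neg]
    ring
  have htr₁₀ : aeval (fun i : Fin 3 => X i + C ((0 : Fin 3 → K) i)) (X 1 * (X 0 * (1 + X 0) + X 2 * Q₁ + X 1 * B₁) + X 2 ^ 2 : MvPolynomial (Fin 3) K) =
      X 1 * (X 0 * (C (1 : K) + X 0) + X 2 * Q₁ + X 1 * B₁) + X 2 ^ 2 := by
    rw [SecondOrderPoint.aeval_translate_zero, map_one]
  have htr₁₁ : aeval (fun i : Fin 3 => X i + C ((- (Pi.single (0 : Fin 3) (1 : K)) : Fin 3 → K) i))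
      (X 1 * (X 0 * (1 + X 0) + X 2 * Q₁ + X 1 * B₁) + X 2 ^ 2 : MvPolynomial (Fin 3) K) =
      X 1 * (X 0 * (C (-1 : K) + X 0) + X 2 * aeval (fun i : Fin 3 => X i + C ((- (Pi.single (0 : Fin 3) (1 : K)) : Fin 3 → K) i)) Q₁ +
        X 1 * aeval (fun i : Fin 3 => X i + C ((- (Pi.single (0 : Fin 3) (1 : K)) : Fin 3 → K) i)) B₁) + X 2 ^ 2 := by
    simp only [map_add, map_mul, map_pow, map_one, aeval_X, Pi.neg_apply, Pi.single_eq_same, Pi.single_eq_of_ne (by decide : (1 : Fin 3) ≠ 0),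
      Pi.single_eq_of_ne (by decide : (2 : Fin 3) ≠ 0), neg_zero, map_zero, add_zero, map_neg]
    ring
  have hc1 : (-1 : K) ≠ 0 := neg_ne_zero.mpr one_ne_zero
  refine towerLevel_succ_origin_marked K D hD0 hDsucc 0 (X 2 ^ 2) (X 0 ^ 2 * X 1 + X 0 * X 1 ^ 2 + (X 2 * Q + B)) (by norm_num) hΦ hΦ0 hΨ
    ![X 0 * (X 1 * (1 + X 1) + X 2 * Q₀ + X 0 * B₀) + X 2 ^ 2, X 1 * (X 0 * (1 + X 0) + X 2 * Q₁ + X 1 * B₁) + X 2 ^ 2, G₂] (fun a => ?_)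
    ![{(0 : Fin 3 → K), -(Pi.single (1 : Fin 3) (1 : K))}, {(0 : Fin 3 → K), -(Pi.single (0 : Fin 3) (1 : K))}, ∅]
    (fun a P hP haP hGP => ?_) (fun a lam hlam _ => ?_) y₀ hy₀
  · fin_cases a
    · exact hG₀
    · exact hG₁
    · exact hG₂
  · fin_cases a
    · by_cases hall : ∀ j, pderiv j (X 0 * (X 1 * (1 + X 1) + X 2 * Q₀ + X 0 * B₀) + X 2 ^ 2 : MvPolynomial (Fin 3) K) ∈ P
      · right
        have h2 := SecondOrderPoint.X_two_mem_of_linear' K _ P hP haP hGP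
        have hA := SecondOrderPoint.mem_of_pderiv_linear' K (l := 0) (by decide) _ P haP (hall 0)
        have hj : (X 1 * (1 + X 0 ^ 0 * X 1 ^ (0 + 1)) : MvPolynomial (Fin 3) K) ∈ P := by
          have e : (X 1 * (1 + X 0 ^ 0 * X 1 ^ (0 + 1)) : MvPolynomial (Fin 3) K) =
              (X 1 * (1 + X 1) + X 2 * Q₀ + X 0 * B₀) - (Q₀ * X 2 + B₀ * X 0) := by ring
          rw [e]; exact P.sub_mem hA (P.add_mem (P.mul_mem_left _ h2) (P.mul_mem_left _ haP))
        rcases SecondOrderPoint.D₄'_marks K P hP (l := 0) (j := 1) (by decide) (by decide) (by decide) haP h2 hj with h | h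
        · refine ⟨0, ?_, ?_⟩
          · exact Finset.mem_insert_self _ _
          · exact h
        · refine ⟨-(Pi.single (1 : Fin 3) (1 : K)), ?_, ?_⟩
          · exact Finset.mem_insert_of_mem (Finset.mem_singleton_self _)
          · exact h
      · left
        push Not at hall
        exact hall
    · by_cases hall : ∀ j, pderiv j (X 1 * (X 0 * (1 + X 0) + X 2 * Q₁ + X 1 * B₁) + X 2 ^ 2 : MvPolynomial (Fin 3) K) ∈ P
      · right
        have h2 := SecondOrderPoint.X_two_mem_of_linear' K _ P hP haP hGP
        have hA := SecondOrderPoint.mem_of_pderiv_linear' K (l := 1) (by decide) _ P haP (hall 1)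
        have hj : (X 0 * (1 + X 1 ^ 0 * X 0 ^ (0 + 1)) : MvPolynomial (Fin 3) K) ∈ P := by
          have e : (X 0 * (1 + X 1 ^ 0 * X 0 ^ (0 + 1)) : MvPolynomial (Fin 3) K) =
              (X 0 * (1 + X 0) + X 2 * Q₁ + X 1 * B₁) - (Q₁ * X 2 + B₁ * X 1) := by ring
          rw [e]; exact P.sub_mem hA (P.add_mem (P.mul_mem_left _ h2) (P.mul_mem_left _ haP))
        rcases SecondOrderPoint.D₄'_marks K P hP (l := 1) (j := 0) (by decide) (by decide) (by decide) haP h2 hj with h | h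
        · refine ⟨0, ?_, ?_⟩
          · exact Finset.mem_insert_self _ _
          · exact h
        · refine ⟨-(Pi.single (0 : Fin 3) (1 : K)), ?_, ?_⟩
          · exact Finset.mem_insert_of_mem (Finset.mem_singleton_self _)
          · exact h
      · left
        push Not at hall
        exact hall
    · exact (hJ₂ P hP haP hGP).elim
  · fin_cases a
    · simp only [Fin.zero_eta, Matrix.cons_val_zero, Finset.mem_insert, Finset.mem_singleton] at hlam
      rcases hlam with rfl | rfl
      · obtain ⟨q, b, Ψ₁, Ψ'', hΨ₁, hΨ'', heq⟩ := hsplit₀ 1 Q₀ B₀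
        refine ⟨2, _, Ψ₁ + Ψ'', by norm_num, (SecondOrderPoint.nodeL₀_cone K 1 q b).1, FirstOrderPoint.add_mem_pow_succ K hΨ₁ hΨ'', ?_,
          hpay₀ 1 q b one_ne_zero Ψ₁ Ψ'' hΨ₁ hΨ''⟩
        exact htr₀₀.trans heq
      · obtain ⟨q, b, Ψ₁, Ψ'', hΨ₁, hΨ'', heq⟩ := hsplit₀ (-1) _ _
        refine ⟨2, _, Ψ₁ + Ψ'', by norm_num, (SecondOrderPoint.nodeL₀_cone K (-1) q b).1, FirstOrderPoint.add_mem_pow_succ K hΨ₁ hΨ'', ?_,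
          hpay₀ (-1) q b hc1 Ψ₁ Ψ'' hΨ₁ hΨ''⟩
        exact htr₀₁.trans heq
    · simp only [Fin.mk_one, Matrix.cons_val_one, Matrix.cons_val_zero, Finset.mem_insert, Finset.mem_singleton] at hlam
      rcases hlam with rfl | rfl
      · obtain ⟨q, b, Ψ₁, Ψ'', hΨ₁, hΨ'', heq⟩ := hsplit₁ 1 Q₁ B₁
        refine ⟨2, _, Ψ₁ + Ψ'', by norm_num, (SecondOrderPoint.nodeL₁_cone K 1 q b).1, FirstOrderPoint.add_mem_pow_succ K hΨ₁ hΨ'', ?_,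
          hpay₁ 1 q b one_ne_zero Ψ₁ Ψ'' hΨ₁ hΨ''⟩
        exact htr₁₀.trans heq
      · obtain ⟨q, b, Ψ₁, Ψ'', hΨ₁, hΨ'', heq⟩ := hsplit₁ (-1) _ _
        refine ⟨2, _, Ψ₁ + Ψ'', by norm_num, (SecondOrderPoint.nodeL₁_cone K (-1) q b).1, FirstOrderPoint.add_mem_pow_succ K hΨ₁ hΨ'', ?_,
          hpay₁ (-1) q b hc1 Ψ₁ Ψ'' hΨ₁ hΨ''⟩
        exact htr₁₁.trans heq
    · exact absurd hlam (Finset.notMem_empty _)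

end OneStep

end Summit.ResolutionOfSingularities.ResolutionOfSingularities.Cruxes.EquisingularLiftNat.Sections

end
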